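import Summits.Ventures.PercRepro.NullityOne
import Summits.Ventures.PercRepro.ProfileTwoHallBase
import Summits.Ventures.PercRepro.HallDisjointMeets

/-!
# PercRepro — THE BASE CASE OF THE HALL ROW: NULLITY 0 AND 1 DONE, NULLITY 2 THE ONLY HYPOTHESIS
(p10, gen 4; `proofs/P10-HALLROW.md` §5)

On `u + 2` elements a simple matroid of rank `≥ u` has nullity `0`, `1` or `2`.  Nullity `0`: every pair is
co-independent and the Kneser double count gives Hall (`hall_coIndep_of_nullity_zero`).  Nullity `1`: the
co-independent pairs are the pairs meeting the unique circuit `D` (NullityOne), `|D| ≥ 3` by simplicity, and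
`hall_disjoint_meets` gives Hall outside `(|D|, c) ∈ {(3,2), (3,3)}`, which cannot occur for `u ≥ 5`
(`hall_coIndep_of_nullity_one`).  So for `u ≥ 5` the base `HallBase α u` — hence the whole Hall row — rests on the
nullity-2 case alone (`hallBase_of_nullity_two_hall`, `hallIneq_two_all_of_nullity_two_hall`); the levels
`u = 3, 4` are night-3's unconditional rows `(2,3)`, `(2,4)`.

* `coIndepPairs_eq_powersetCard_of_indep` — nullity `0`;
* `three_le_card_nonColoops`, `coIndepPairs_eq_pairsMeeting` — nullity `1`;
* `hall_coIndep_of_nullity_zero`, `hall_coIndep_of_nullity_one` — Hall in the two cases;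
* **`hallBase_of_nullity_two_hall`**, **`hallIneq_two_all_of_nullity_two_hall`** — the row modulo nullity `2`.
-/

open scoped Matroid

namespace PercRepro.Cogirth

open Finset ThmH Skew Shadow Profile HallDisjoint

variable {α : Type} [DecidableEq α] {M : Matroid α} [M.Finite]

/-! ### Nullity 0 -/

/-- If the ground set is independent, every pair of a simple matroid is co-independent. -/
theorem coIndepPairs_eq_powersetCard_of_indep (hs : Simple' M) (hE : M.Indep ((gr M : Finset α) : Set α)) :
    coIndepPairs M = (gr M).powersetCard 2 := by
  ext C
  rw [mem_coIndepPairs, mem_indepSets, mem_powersetCard]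
  constructor
  · rintro ⟨⟨h1, h2, _⟩, _⟩
    exact ⟨h1, h2⟩
  · rintro ⟨h1, h2⟩
    exact ⟨⟨h1, h2, hs C h1 (by omega)⟩, hE.subset (by exact_mod_cast (sdiff_subset : gr M \ C ⊆ gr M))⟩

/-- Hall for disjointness on the co-independent pairs when the ground set is independent (`≥ 4` elements). -/
theorem hall_coIndep_of_nullity_zero (hs : Simple' M) (hE : M.Indep ((gr M : Finset α) : Set α))
    (h4 : 4 ≤ (gr M).card) {𝒜 : Finset (Finset α)} (h𝒜 : 𝒜 ⊆ coIndepPairs M) :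
    𝒜.card ≤ (nbr (coIndepPairs M) 𝒜).card := by
  rw [coIndepPairs_eq_powersetCard_of_indep hs hE] at h𝒜 ⊢
  exact hall_disjoint_all_pairs (gr M) h4 h𝒜

/-! ### Nullity 1 -/

/-- In a simple matroid of nullity one the circuit `D` has at least three elements. -/
theorem three_le_card_nonColoops (hs : Simple' M) (hnul : (gr M).card = rk M (gr M) + 1) :
    3 ≤ (nonColoops M).card := by
  have h := rk_nonColoops_of_nullity_one hnul
  by_contra hcon
  have hind : M.Indep ((nonColoops M : Finset α) : Set α) :=
    hs _ (sdiff_subset : nonColoops M ⊆ gr M) (by omega)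
  have := rk_eq_card_of_indep hind
  omega

/-- In a simple matroid of nullity one the co-independent pairs are the pairs meeting `D`. -/
theorem coIndepPairs_eq_pairsMeeting (hs : Simple' M) (hnul : (gr M).card = rk M (gr M) + 1) :
    coIndepPairs M = pairsMeeting (gr M) (nonColoops M) := by
  ext C
  rw [mem_coIndepPairs, mem_indepSets, mem_pairsMeeting, coIndep_pair_iff_of_nullity_one hnul C]
  constructor
  · rintro ⟨⟨h1, h2, _⟩, h3⟩
    exact ⟨⟨h1, h2⟩, h3⟩
  · rintro ⟨⟨h1, h2⟩, h3⟩
    exact ⟨⟨h1, h2, hs C h1 (by omega)⟩, h3⟩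

/-- Hall for disjointness on the co-independent pairs of a simple matroid of nullity one on `≥ 7` elements. -/
theorem hall_coIndep_of_nullity_one (hs : Simple' M) (hnul : (gr M).card = rk M (gr M) + 1)
    (h7 : 7 ≤ (gr M).card) {𝒜 : Finset (Finset α)} (h𝒜 : 𝒜 ⊆ coIndepPairs M) :
    𝒜.card ≤ (nbr (coIndepPairs M) 𝒜).card := by
  rw [coIndepPairs_eq_pairsMeeting hs hnul] at h𝒜 ⊢
  have hD : nonColoops M ⊆ gr M := sdiff_subset
  have hcard : (gr M \ nonColoops M).card + (nonColoops M).card = (gr M).card :=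
    card_sdiff_add_card_eq_card hD
  exact hall_disjoint_meets hD (three_le_card_nonColoops hs hnul) (by omega) (by omega) (by omega) h𝒜

/-! ### The assembly: nullity 2 is the only hypothesis -/

/-- **The base case of the Hall row, modulo nullity 2**: for `u ≥ 5`, if Hall for disjointness holds on the
co-independent pairs of every simple matroid of nullity `2` on `u + 2` elements, then `HallBase α u`. -/
theorem hallBase_of_nullity_two_hall {u : ℕ} (hu : 5 ≤ u)
    (h2 : ∀ (N : Matroid α) [N.Finite], Simple' N → (gr N).card = u + 2 → rk N (gr N) = u →
      ∀ 𝒜 ⊆ coIndepPairs N, 𝒜.card ≤ (nbr (coIndepPairs N) 𝒜).card) :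
    HallBase α u := by
  apply hallBase_of_hall_disjoint (by omega)
  intro N _ hs hn 𝒜 h𝒜
  have hrk : rk N (gr N) ≤ (gr N).card := rk_le_card _
  rcases Nat.lt_or_ge (rk N (gr N)) u with hlt | hge
  · -- rank below `u`: no pair is co-independent
    have hempty : coIndepPairs N = ∅ := by
      rw [eq_empty_iff_forall_notMem]
      intro C hC
      rw [mem_coIndepPairs, mem_indepSets] at hC
      have h1 := rk_eq_card_of_indep hC.2
      rw [card_sdiff_of_subset hC.1.1, hC.1.2.1, hn] at h1
      have h2 := rk_mono' (M := N) (sdiff_subset : gr N \ C ⊆ gr N)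
      omega
    rw [hempty, subset_empty] at h𝒜
    rw [h𝒜, card_empty]
    exact Nat.zero_le _
  rcases Nat.lt_or_ge (rk N (gr N)) (u + 1) with h0 | h1
  · exact h2 N hs hn (by omega) 𝒜 h𝒜
  rcases Nat.lt_or_ge (rk N (gr N)) (u + 2) with h0' | h1'
  · exact hall_coIndep_of_nullity_one hs (by omega) (by omega) h𝒜
  · have hE : N.Indep ((gr N : Finset α) : Set α) := indep_of_rk_eq_card (by omega)
    exact hall_coIndep_of_nullity_zero hs hE (by omega) h𝒜

/-- **The Hall row `(H⁺_{2,u})` for every finite matroid and every `u ≥ 5`, modulo Hall for disjointness on the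
co-independent pairs of the simple matroids of nullity 2 on `u + 2` elements** (the levels `u = 3, 4` are night-3's
unconditional rows). -/
theorem hallIneq_two_all_of_nullity_two_hall {u : ℕ} (hu : 5 ≤ u)
    (h2 : ∀ (N : Matroid α) [N.Finite], Simple' N → (gr N).card = u + 2 → rk N (gr N) = u →
      ∀ 𝒜 ⊆ coIndepPairs N, 𝒜.card ≤ (nbr (coIndepPairs N) 𝒜).card)
    (M : Matroid α) [M.Finite] : HallIneq M 2 u :=
  hallIneq_two_all_of_base (by omega) (hallBase_of_nullity_two_hall hu h2) M

end PercRepro.Cogirth
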